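import Literature.NumberTheory.ModularForms.Lemma49Plus8Rows
import HarnessLib

/-!
# CKMRV Lemma 4.9 (4.16) for `𝒦₊^{(8)}`: the non-decaying part `𝒢₊^{(8)}` and the bound

Cohn–Kumar–Miller–Radchenko–Viazovska, arXiv:1902.05438, §4.4 and Lemma 4.9 (4.16): `𝒢₊^{(d)}(τ,z)`
is the sum of the `e^{nπiz}`, `n ≤ 0`, terms of the expansion of `𝒦₊^{(d)}(τ,z)` in powers of
`e^{πiz}` ("polynomials in `z` of degree at most `2`" — in fact `≤ 1`), `𝒢^{(8)}_{−1,j,±} = 0`, and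
(4.16) `|((𝒦₊ − 𝒢₊)|^τ γ)(τ,z)| ≤ C|e^{πi n_{+,z} z}τ²z²/(Δ(τ)Δ(z)(j(τ)−j(z)))|`, `n_{+,z} = 2`.

For the row-parametrised kernel `plus8Kernel R` (rows `R = φ|γ`), the `q_z⁰`-part of
`N_R = plus8Kernel R · Δ(τ)Δ(z)(j(τ)−j(z))` is `Δ(τ)·c[R₋₂E₆(−12iz/π − 36/π²) + (12i/π)zR₀E₄]`, so
**`𝒢_R(τ,z) = c[(12i/π)z(R₋₂E₆ − R₀E₄)(τ) + (36/π²)R₋₂E₆(τ)]`** (`plus8G`; `c = π²/(36i)`), a polynomial of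
degree `1` in `z` with no `e^{−2πiz}`-term. PROVED: the multiplied-out identity
`(plus8Kernel R − 𝒢_R)·ΔΔ(j−j) = M_R` off the poles (`plus8Kernel_sub_G_mul_eq`), a decomposition of
`M_R` into products each carrying an `O(e^{−2π Im z})` factor (`plus8M_decomp`), and **(4.16) for
rows that are `O(|τ|²)` on half-planes** (`plus8Kernel_sub_G_bound_416`), hence for
`γ = I, T, TS` (`kernelPlus8_sub_G_bound_416`).

## References

* H. Cohn, A. Kumar, S. D. Miller, D. Radchenko, M. Viazovska, Ann. of Math. 196 (2022),
  arXiv:1902.05438, §4.4 (definition of `𝒢`), Lemma 4.9 (4.16). [CohnEtAl2019]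
-/

noncomputable section

open Complex hiding I
open Filter Topology Asymptotics ModularForm SlashInvariantForm EisensteinSeries
open UpperHalfPlane hiding I
open Complex (I)
open scoped Real MatrixGroups ModularForm Manifold

namespace Literature.NumberTheory.ModularForms

open Literature.NumberTheory.EllipticCurves.ModularForms (kleinJ E₄_cube_eq_kleinJ_mul)

/-- **`𝒢_R(τ,z) = c[(12i/π)z(R₋₂E₆ − R₀E₄)(τ) + (36/π²)R₋₂E₆(τ)]`**, the non-decaying part in `z` of
`plus8Kernel R` (`𝒢₊^{(8)} = plus8G φ₋₂ φ₀`). [cite: CohnEtAl2019, §4.4] -/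
def plus8G (Rm R0 : ℍ → ℂ) (τ z : ℍ) : ℂ :=
  (π : ℂ) ^ 2 / (36 * I) * (12 * I / π * (z : ℂ) * (Rm τ * E₆ τ - R0 τ * E₄ τ) + 36 / π ^ 2 * (Rm τ * E₆ τ))

/-- The multiplied-out remainder `M_R = N_R − 𝒢_R·Δ(τ)Δ(z)(j(τ)−j(z))`. [cite: CohnEtAl2019, Lemma 4.9 (proof)] -/
def plus8M (Rm R0 R2 : ℍ → ℂ) (τ z : ℍ) : ℂ :=
  (π : ℂ) ^ 2 / (36 * I) *
    (Rm τ * E₆ τ * ((E₄ τ ^ 3 * ModularForm.discriminant z - E₄ z ^ 3 * ModularForm.discriminant τ) * phiTildeNeg2 z +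
        ModularForm.discriminant τ * (E8fun z * phiTilde2 z)) +
      R0 τ * E₄ τ * (-2 * (E₄ τ ^ 3 * ModularForm.discriminant z - E₄ z ^ 3 * ModularForm.discriminant τ) * phiTildeNeg2 z -
        2 * ModularForm.discriminant τ * (E10fun z * phiTilde0 z)) +
      R2 τ * E14fun τ * (ModularForm.discriminant z * phiTildeNeg2 z))
  - plus8G Rm R0 τ z * (E₄ τ ^ 3 * ModularForm.discriminant z - E₄ z ^ 3 * ModularForm.discriminant τ)

/-- `plus8Kernel_sub_G_mul_eq` (auxiliary). [cite: CohnEtAl2019, Lemma 4.9 (proof)] -/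
theorem plus8Kernel_sub_G_mul_eq (Rm R0 R2 : ℍ → ℂ) (τ z : ℍ) (hJ : kleinJ τ - kleinJ z ≠ 0) :
    (plus8Kernel Rm R0 R2 τ z - plus8G Rm R0 τ z) *
      (ModularForm.discriminant τ * ModularForm.discriminant z * (kleinJ τ - kleinJ z)) = plus8M Rm R0 R2 τ z := by
  have hΔz := ModularForm.discriminant_ne_zero z
  have hΔτ := ModularForm.discriminant_ne_zero τ
  have e1 : kleinJ τ = E₄ τ ^ 3 / ModularForm.discriminant τ := by rw [eq_div_iff hΔτ]; exact (E₄_cube_eq_kleinJ_mul τ).symm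
  have e2 : kleinJ z = E₄ z ^ 3 / ModularForm.discriminant z := by rw [eq_div_iff hΔz]; exact (E₄_cube_eq_kleinJ_mul z).symm
  simp only [plus8Kernel, plus8M, plus8G, E14fun, f2fun, Pi.mul_apply, Pi.inv_apply]
  field_simp
  rw [e1, e2]
  field_simp

/-- `norm_plus8Kernel_sub_G_mul_le` (auxiliary). [cite: CohnEtAl2019, Lemma 4.9 (proof)] -/
theorem norm_plus8Kernel_sub_G_mul_le (Rm R0 R2 : ℍ → ℂ) (τ z : ℍ) :
    ‖(plus8Kernel Rm R0 R2 τ z - plus8G Rm R0 τ z) *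
      (ModularForm.discriminant τ * ModularForm.discriminant z * (kleinJ τ - kleinJ z))‖ ≤ ‖plus8M Rm R0 R2 τ z‖ := by
  by_cases hJ : kleinJ τ - kleinJ z = 0
  · rw [hJ]; simp
  · rw [plus8Kernel_sub_G_mul_eq Rm R0 R2 τ z hJ]

/-- **Decomposition of `M_R`**: every term carries a factor vanishing to order `q_z`.
[cite: CohnEtAl2019, Lemma 4.9 (proof)] -/
theorem plus8M_decomp (Rm R0 R2 : ℍ → ℂ) (τ z : ℍ) : plus8M Rm R0 R2 τ z = (π : ℂ) ^ 2 / (36 * I) *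
    ( Rm τ * E₆ τ * E₄ τ ^ 3 * (ModularForm.discriminant z * ((z : ℂ) ^ 2 - 12 * I / π * z - 36 / π ^ 2))
      + Rm τ * E₆ τ * ModularForm.discriminant τ *
          (-(E₄ z ^ 3 - 1) * ((z : ℂ) - 6 * I / π) ^ 2 + (E8fun z - 1) * phiTilde2 z + (phiTilde2 z - ((z : ℂ) - 6 * I / π) ^ 2))
      + R0 τ * E₄ τ * E₄ τ ^ 3 * (ModularForm.discriminant z * (-2 * (z : ℂ) ^ 2 + 12 * I / π * z))
      + R0 τ * E₄ τ * ModularForm.discriminant τ *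
          ((E₄ z ^ 3 - 1) * (2 * (z : ℂ) ^ 2 - 12 * I / π * z) - 2 * (E10fun z - 1) * phiTilde0 z
            - 2 * ((z : ℂ) ^ 2 * (E2 z - 1)))
      + R2 τ * E14fun τ * (ModularForm.discriminant z * (z : ℂ) ^ 2) ) := by
  have hπ : (π : ℂ) ≠ 0 := ofReal_ne_zero.2 Real.pi_ne_zero
  simp only [plus8M, plus8G, phiTildeNeg2, phiTilde0, E10fun, E8fun, Pi.mul_apply]
  field_simp
  ring_nf
  simp only [I_sq]
  ring_nf

/-- The `z`-side factors are `O(|z|² e^{−2π Im z})` on half-planes. [cite: CohnEtAl2019, Lemma 4.9 (proof)] -/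
theorem zSide_G_isBigO {δ : ℝ} (hδ : 0 < δ) :
    ((fun z : ℍ => ModularForm.discriminant z * ((z : ℂ) ^ 2 - 12 * I / π * z - 36 / π ^ 2)) =O[𝓟 (halfPlane δ)]
        fun z : ℍ => ‖(z : ℂ)‖ ^ 2 * expDecay z) ∧
    ((fun z : ℍ => -(E₄ z ^ 3 - 1) * ((z : ℂ) - 6 * I / π) ^ 2 + (E8fun z - 1) * phiTilde2 z + (phiTilde2 z - ((z : ℂ) - 6 * I / π) ^ 2))
        =O[𝓟 (halfPlane δ)] fun z : ℍ => ‖(z : ℂ)‖ ^ 2 * expDecay z) ∧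
    ((fun z : ℍ => ModularForm.discriminant z * (-2 * (z : ℂ) ^ 2 + 12 * I / π * z)) =O[𝓟 (halfPlane δ)]
        fun z : ℍ => ‖(z : ℂ)‖ ^ 2 * expDecay z) ∧
    ((fun z : ℍ => (E₄ z ^ 3 - 1) * (2 * (z : ℂ) ^ 2 - 12 * I / π * z) - 2 * (E10fun z - 1) * phiTilde0 z
          - 2 * ((z : ℂ) ^ 2 * (E2 z - 1))) =O[𝓟 (halfPlane δ)] fun z : ℍ => ‖(z : ℂ)‖ ^ 2 * expDecay z) ∧
    ((fun z : ℍ => ModularForm.discriminant z * (z : ℂ) ^ 2) =O[𝓟 (halfPlane δ)] fun z : ℍ => ‖(z : ℂ)‖ ^ 2 * expDecay z) := by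
  obtain ⟨h4, h6, h2, hΔ, hE4, hE6, hE2, h1, hcoe, hq1⟩ := halfPlane_isBigO_basic hδ
  obtain ⟨f1, f2, f3, f4, f5, f6, f7, f8, z1, z2, z3⟩ := halfPlane_isBigO_factors hδ
  obtain ⟨_, _, _, _, ht0', ht2'⟩ := rows_isBigO_sq hδ
  obtain ⟨_, hφ0, hφ2⟩ := halfPlane_isBigO_phi hδ
  -- `φ̃₀, φ̃₂ = O(|z|²)` (from `−φ + φ̃ = O(|z|²)` and `φ = O(|z|) = O(|z|²)`)
  have up : ∀ {f : ℍ → ℂ}, f =O[𝓟 (halfPlane δ)] (fun τ : ℍ => ‖(τ : ℂ)‖) → f =O[𝓟 (halfPlane δ)] fun τ : ℍ => ‖(τ : ℂ)‖ ^ 2 := by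
    intro f hf
    refine hf.trans ?_
    rw [isBigO_principal]
    refine ⟨1 / δ, fun τ hτ => ?_⟩
    have hτ1 : δ ≤ ‖(τ : ℂ)‖ := (mem_halfPlane.1 hτ).trans (im_le_norm_coe τ)
    rw [norm_norm, Real.norm_of_nonneg (sq_nonneg _), sq, one_div, ← mul_assoc, inv_mul_eq_div]
    exact le_mul_of_one_le_left (norm_nonneg _) (by rw [le_div_iff₀ hδ, one_mul]; exact hτ1)
  have ht0 : phiTilde0 =O[𝓟 (halfPlane δ)] fun z : ℍ => ‖(z : ℂ)‖ ^ 2 := by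
    have := ht0'.add (up hφ0); exact this.congr_left fun z => by simp
  have ht2 : phiTilde2 =O[𝓟 (halfPlane δ)] fun z : ℍ => ‖(z : ℂ)‖ ^ 2 := by
    have := ht2'.add (up hφ2); exact this.congr_left fun z => by simp
  have hsq : (fun z : ℍ => (z : ℂ) ^ 2) =O[𝓟 (halfPlane δ)] fun z : ℍ => ‖(z : ℂ)‖ ^ 2 := by simpa [sq] using hcoe.mul hcoe
  have hone : (fun _ : ℍ => (1 : ℂ)) =O[𝓟 (halfPlane δ)] fun z : ℍ => ‖(z : ℂ)‖ ^ 2 := up h1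
  have hz1 : (fun z : ℍ => (z : ℂ)) =O[𝓟 (halfPlane δ)] fun z : ℍ => ‖(z : ℂ)‖ ^ 2 := up hcoe
  -- quadratic polynomials in `z` are `O(|z|²)`
  have poly : ∀ (a b c : ℂ), (fun z : ℍ => a * (z : ℂ) ^ 2 + b * z + c) =O[𝓟 (halfPlane δ)] fun z : ℍ => ‖(z : ℂ)‖ ^ 2 := by
    intro a b c
    have := ((hsq.const_mul_left a).add (hz1.const_mul_left b)).add (hone.const_mul_left c)
    exact this.congr_left fun z => by ring
  -- products `poly(z) · O(q_z)`
  have PQ : ∀ {u v : ℍ → ℂ}, u =O[𝓟 (halfPlane δ)] (fun z : ℍ => ‖(z : ℂ)‖ ^ 2) → v =O[𝓟 (halfPlane δ)] expDecay →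
      (fun z => u z * v z) =O[𝓟 (halfPlane δ)] fun z : ℍ => ‖(z : ℂ)‖ ^ 2 * expDecay z := fun hu hv => hu.mul hv
  refine ⟨?_, ?_, ?_, ?_, ?_⟩
  · have := PQ (poly 1 (-(12 * I / π)) (-(36 / π ^ 2))) hΔ
    exact this.congr_left fun z => by ring
  · have t1 := PQ (poly 1 (-(6 * I / π) * 2) ((6 * I / π) ^ 2)) z1   -- `(z − 6i/π)² · (E₄³ − 1)`
    -- `E₈ − 1 = (E₄ − 1)(E₄ + 1)`
    have hE8 : (fun z : ℍ => E8fun z - 1) =O[𝓟 (halfPlane δ)] expDecay := by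
      have := h4.mul (hE4.add (isBigO_const_const (1 : ℂ) one_ne_zero _))
      refine (this.congr_left fun z => by simp only [E8fun, Pi.mul_apply]; ring).congr_right fun z => by simp
    have t2 : (fun z : ℍ => (E8fun z - 1) * phiTilde2 z) =O[𝓟 (halfPlane δ)] fun z : ℍ => ‖(z : ℂ)‖ ^ 2 * expDecay z :=
      (PQ ht2 hE8).congr_left fun z => by ring
    -- `φ̃₂ − (z − 6i/π)² = z(E₂ − 1)(zE₂ + z − 12i/π)`
    have t3 : (fun z : ℍ => phiTilde2 z - ((z : ℂ) - 6 * I / π) ^ 2) =O[𝓟 (halfPlane δ)] fun z : ℍ => ‖(z : ℂ)‖ ^ 2 * expDecay z := by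
      have hlin : (fun z : ℍ => (z : ℂ) * E2 z + z - 12 * I / π) =O[𝓟 (halfPlane δ)] fun z : ℍ => ‖(z : ℂ)‖ := by
        have a1 : (fun z : ℍ => (z : ℂ) * E2 z) =O[𝓟 (halfPlane δ)] fun z : ℍ => ‖(z : ℂ)‖ := by simpa using hcoe.mul hE2
        have a2 : (fun _ : ℍ => (12 * I / π : ℂ)) =O[𝓟 (halfPlane δ)] fun z : ℍ => ‖(z : ℂ)‖ := by
          simpa using h1.const_mul_left (12 * I / π : ℂ)
        exact (a1.add hcoe).sub a2
      have := (hcoe.mul h2).mul hlin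
      refine (this.congr_left fun z => ?_).congr_right fun z => by ring
      simp only [phiTilde2]; ring
    have := (t1.neg_left.add t2).add t3
    exact this.congr_left fun z => by ring
  · have := PQ (poly (-2) (12 * I / π) 0) hΔ
    exact this.congr_left fun z => by ring
  · have t1 := PQ (poly 2 (-(12 * I / π)) 0) z1
    have t2 : (fun z : ℍ => (E10fun z - 1) * phiTilde0 z) =O[𝓟 (halfPlane δ)] fun z : ℍ => ‖(z : ℂ)‖ ^ 2 * expDecay z := by
      have hE10 : (fun z : ℍ => E10fun z - 1) =O[𝓟 (halfPlane δ)] expDecay := by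
        have h46 : (fun z : ℍ => (E₄ z - 1) * E₆ z) =O[𝓟 (halfPlane δ)] expDecay := by simpa using h4.mul hE6
        have := h46.add h6
        exact this.congr_left fun z => by simp only [E10fun, Pi.mul_apply]; ring
      have := ht0.mul hE10
      exact this.congr_left fun z => by ring
    have t3 : (fun z : ℍ => (z : ℂ) ^ 2 * (E2 z - 1)) =O[𝓟 (halfPlane δ)] fun z : ℍ => ‖(z : ℂ)‖ ^ 2 * expDecay z := PQ hsq h2
    have := (t1.sub (t2.const_mul_left 2)).sub (t3.const_mul_left 2)
    exact this.congr_left fun z => by ring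
  · simpa [mul_comm] using PQ hsq hΔ

/-- **Lemma 4.9 (4.16) for `O(|τ|²)` rows** (multiplied-out): on `Im τ, Im z ≥ δ`,
`‖(plus8Kernel R − 𝒢_R)(τ,z)·Δ(τ)Δ(z)(j(τ)−j(z))‖ ≤ C|τ|²|z|²e^{−2π Im z}`. [cite: CohnEtAl2019, Lemma 4.9 (4.16)] -/
theorem plus8Kernel_sub_G_bound_416 {δ : ℝ} (hδ : 0 < δ) {Rm R0 R2 : ℍ → ℂ}
    (hm : Rm =O[𝓟 (halfPlane δ)] fun τ : ℍ => ‖(τ : ℂ)‖ ^ 2) (h0 : R0 =O[𝓟 (halfPlane δ)] fun τ : ℍ => ‖(τ : ℂ)‖ ^ 2)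
    (h2 : R2 =O[𝓟 (halfPlane δ)] fun τ : ℍ => ‖(τ : ℂ)‖ ^ 2) :
    ∃ C : ℝ, ∀ τ z : ℍ, δ ≤ τ.im → δ ≤ z.im →
      ‖(plus8Kernel Rm R0 R2 τ z - plus8G Rm R0 τ z) *
        (ModularForm.discriminant τ * ModularForm.discriminant z * (kleinJ τ - kleinJ z))‖
          ≤ C * (‖(τ : ℂ)‖ ^ 2 * ‖(z : ℂ)‖ ^ 2 * expDecay z) := by
  obtain ⟨h4, h6, hE2m, hΔ, hE4, hE6, hE2, h1, hcoe, hq1⟩ := halfPlane_isBigO_basic hδ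
  obtain ⟨_, _, _, _, f5, _⟩ := halfPlane_isBigO_factors hδ
  obtain ⟨g1, g2, g3, g4, g5⟩ := zSide_G_isBigO hδ
  set F := 𝓟 (halfPlane δ ×ˢ halfPlane δ)
  have bb : ∀ {u v : ℍ → ℂ}, u =O[𝓟 (halfPlane δ)] (fun _ : ℍ => (1 : ℝ)) → v =O[𝓟 (halfPlane δ)] (fun _ : ℍ => (1 : ℝ)) →
      (fun τ => u τ * v τ) =O[𝓟 (halfPlane δ)] fun _ : ℍ => (1 : ℝ) := fun hu hv => by simpa using hu.mul hv
  have hE4_3 : (fun τ : ℍ => E₄ τ ^ 3) =O[𝓟 (halfPlane δ)] fun _ : ℍ => (1 : ℝ) := by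
    have h2' : (fun τ : ℍ => E₄ τ ^ 2) =O[𝓟 (halfPlane δ)] fun _ : ℍ => (1 : ℝ) := by simpa [sq] using bb hE4 hE4
    simpa [pow_succ] using bb h2' hE4
  have hΔ1 : (ModularForm.discriminant : ℍ → ℂ) =O[𝓟 (halfPlane δ)] fun _ : ℍ => (1 : ℝ) := hΔ.trans hq1
  have T : ∀ {a u g : ℍ → ℂ}, a =O[𝓟 (halfPlane δ)] (fun τ : ℍ => ‖(τ : ℂ)‖ ^ 2) →
      u =O[𝓟 (halfPlane δ)] (fun _ : ℍ => (1 : ℝ)) → g =O[𝓟 (halfPlane δ)] (fun z : ℍ => ‖(z : ℂ)‖ ^ 2 * expDecay z) →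
      (fun p : ℍ × ℍ => a p.1 * u p.1 * g p.2) =O[F] fun p => ‖(p.1 : ℂ)‖ ^ 2 * (‖(p.2 : ℂ)‖ ^ 2 * expDecay p.2) := by
    intro a u g ha hu hg
    have := ((isBigO_fst_of_halfPlane ha).mul (isBigO_fst_of_halfPlane hu)).mul (isBigO_snd_of_halfPlane hg)
    simpa using this
  have s1 := T hm (bb hE6 hE4_3) g1
  have s2 := T hm (bb hE6 hΔ1) g2
  have s3 := T h0 (bb hE4 hE4_3) g3
  have s4 := T h0 (bb hE4 hΔ1) g4
  have s5 := T h2 f5 g5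
  have total := ((((s1.add s2).add s3).add s4).add s5).const_mul_left ((π : ℂ) ^ 2 / (36 * I))
  have hO : (fun p : ℍ × ℍ => plus8M Rm R0 R2 p.1 p.2) =O[F] fun p => ‖(p.1 : ℂ)‖ ^ 2 * (‖(p.2 : ℂ)‖ ^ 2 * expDecay p.2) := by
    refine total.congr_left fun p => ?_
    rw [plus8M_decomp]; ring
  obtain ⟨C, hC⟩ := isBigO_principal.1 hO
  refine ⟨C, fun τ z hτ hz => (norm_plus8Kernel_sub_G_mul_le Rm R0 R2 τ z).trans ?_⟩
  have := hC (τ, z) ⟨hτ, hz⟩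
  rw [Real.norm_of_nonneg (mul_nonneg (sq_nonneg _) (mul_nonneg (sq_nonneg _) (expDecay_pos _).le))] at this
  simpa [mul_assoc] using this

/-- **Lemma 4.9 (4.16) for `𝒦₊^{(8)}|₄γ`, `γ ∈ {I, T, TS}`** (multiplied-out; `(𝒦 − 𝒢)|γ` has rows `φ|γ`):
with `𝒢 = plus8G (φ₋₂|γ) (φ₀|γ)`. [cite: CohnEtAl2019, Lemma 4.9 (4.16)] -/
theorem kernelPlus8_sub_G_bound_416 {δ : ℝ} (hδ : 0 < δ) (γ : SL(2, ℤ))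
    (hγ : γ = 1 ∨ γ = ModularGroup.T ∨ γ = ModularGroup.T * ModularGroup.S) :
    ∃ C : ℝ, ∀ τ z : ℍ, δ ≤ τ.im → δ ≤ z.im →
      ‖(((fun σ => kernelPlus8 σ z) ∣[(4 : ℤ)] γ) τ -
          plus8G (phiNeg2 ∣[(-2 : ℤ)] γ) (phi0 ∣[(0 : ℤ)] γ) τ z) *
        (ModularForm.discriminant τ * ModularForm.discriminant z * (kleinJ τ - kleinJ z))‖
          ≤ C * (‖(τ : ℂ)‖ ^ 2 * ‖(z : ℂ)‖ ^ 2 * expDecay z) := by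
  obtain ⟨r1, r2, r3, r4, r5, r6⟩ := rows_isBigO_sq hδ
  obtain ⟨hφm, hφ0, hφ2⟩ := halfPlane_isBigO_phi hδ
  have up : ∀ {f : ℍ → ℂ}, f =O[𝓟 (halfPlane δ)] (fun τ : ℍ => ‖(τ : ℂ)‖) → f =O[𝓟 (halfPlane δ)] fun τ : ℍ => ‖(τ : ℂ)‖ ^ 2 := by
    intro f hf
    refine hf.trans ?_
    rw [isBigO_principal]
    refine ⟨1 / δ, fun τ hτ => ?_⟩
    have hτ1 : δ ≤ ‖(τ : ℂ)‖ := (mem_halfPlane.1 hτ).trans (im_le_norm_coe τ)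
    rw [norm_norm, Real.norm_of_nonneg (sq_nonneg _), sq, one_div, ← mul_assoc, inv_mul_eq_div]
    exact le_mul_of_one_le_left (norm_nonneg _) (by rw [le_div_iff₀ hδ, one_mul]; exact hτ1)
  have main : ∀ {Rm R0 R2 : ℍ → ℂ}, phiNeg2 ∣[(-2 : ℤ)] γ = Rm → phi0 ∣[(0 : ℤ)] γ = R0 → phi2 ∣[(2 : ℤ)] γ = R2 →
      Rm =O[𝓟 (halfPlane δ)] (fun τ : ℍ => ‖(τ : ℂ)‖ ^ 2) → R0 =O[𝓟 (halfPlane δ)] (fun τ : ℍ => ‖(τ : ℂ)‖ ^ 2) →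
      R2 =O[𝓟 (halfPlane δ)] (fun τ : ℍ => ‖(τ : ℂ)‖ ^ 2) →
      ∃ C : ℝ, ∀ τ z : ℍ, δ ≤ τ.im → δ ≤ z.im →
        ‖(((fun σ => kernelPlus8 σ z) ∣[(4 : ℤ)] γ) τ - plus8G (phiNeg2 ∣[(-2 : ℤ)] γ) (phi0 ∣[(0 : ℤ)] γ) τ z) *
          (ModularForm.discriminant τ * ModularForm.discriminant z * (kleinJ τ - kleinJ z))‖
            ≤ C * (‖(τ : ℂ)‖ ^ 2 * ‖(z : ℂ)‖ ^ 2 * expDecay z) := by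
    intro Rm R0 R2 e1 e2 e3 hm h0 h2
    obtain ⟨C, hC⟩ := plus8Kernel_sub_G_bound_416 hδ hm h0 h2
    refine ⟨C, fun τ z hτ hz => ?_⟩
    have := hC τ z hτ hz
    rw [kernelPlus8_eq_plus8Kernel, plus8Kernel_slash, e1, e2, e3]
    exact this
  rcases hγ with rfl | rfl | rfl
  · refine main (by rw [SlashAction.slash_one]) (by rw [SlashAction.slash_one]) (by rw [SlashAction.slash_one])
      (up hφm) (up hφ0) (up hφ2)
  · obtain ⟨hT1, hT2, hT3⟩ := phi_rows_slash_T
    exact main hT1 hT2 hT3 r1 r2 r3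
  · obtain ⟨hS1, hS2, hS3⟩ := phi_rows_slash_TS
    exact main hS1 hS2 hS3 r4 r5 r6

end Literature.NumberTheory.ModularForms
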